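/-
Copyright (c) 2026 the pub-hodgecm-mathlib formalisation cell (harness21).  Prover seat hodgecm-mathlib-F0P3a-p01 (g16): road «S3-ram» (LEAD F0P3a-plan (g12); architect
A-p16 (g31) 23:50:49Z «JUNCTION = yours»), junction brick J8-eq «THE κ-SUM ALGEBRA, EQUILATERAL CONFIGURATION»; 2026-09-02.
-/
import Mathlib
import HarnessLib

/-!
# The ramified type-(1) `κ`-orbital integral: the κ-signed shell sums of the EQUILATERAL root collapse to the five brackets `X̃(n)` (Rogawski 1990 §4.9; Kottwitz 1986 §3)

Topic `NumberTheory/Rogawski1990`; namespace `Literature.NumberTheory.Rogawski1990`.  THEOREMS ONLY (no definition, no instance, no notation, no named fact, no `sorry`); kernel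
lane `--supports stmt-HodgeConjecture-24833`; Mathlib only.  Cell `pub/hodgecm-mathlib` (D-0151), crux H413; road «S3-ram», P-1-ram organ A′ (ii) (a2), JUNCTION brick **J8-eq** of
the plan `STATUS 23:57:42Z` (blueprint `BLUEPRINT-a2B-TreeInduction.v1` §2 (B8)).  PURE ALGEBRA over `ℚ`.

THE MATHEMATICS.  In the equilateral configuration (`N₁ = N₂ = N = 2n+1`, `n = m+1 ≥ 1`) the root `L₀` of the literal `b` has `q·ν_b` fixed grandchildren of label `E_n`,
`q·ν_b^±` of label `P^±_{n−1}` (★ G5 `strataVec_total_eq_of_localLaw_of_root`), and over the four literals `Σ_b κ_b ν_b = 4χ₀`, `Σ_b κ_b ν_b^+ = Σ_b κ_b ν_b^− = −2χ₀`,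
`Σ_b κ_b = 0` (★ `signedSum_card_rootNull_twists`, ★ `signedSum_card_rootClass_twists`, `χ₀ = χ(−u₀u₂AC)`).  Hence `Σ_b κ_b n_{b,·} = χ₀·q·(4·S(E_n) − 2·(S(P⁺_{n−1}) + S(P⁻_{n−1})))`
with the ★ closed forms of `DepthZeroKappaTransferTypeOneRamifiedShellSums`, and THIS FILE is the identity
  `q·(4·S(E_{m+1}) − 2·(S(P⁺_m) + S(P⁻_m))) = q^{2m+3} · X̃(m+1)`,  `X̃(n) = (4qⁿ, 4qⁿ⁻¹, 2(qⁿ−q−1)∕q², 2(qⁿ−q−1)∕q², 4(qⁿ−1)∕((q−1)q²))`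
componentwise over `ℚ` (`q ≥ 2`): slots bd∕reg are monomial identities, slots 1± use `(q−1)·Σ_{i<m} qⁱ = q^m − 1`, slot 0 uses it once more; `S(P⁺_m) + S(P⁻_m) =
(0, 0, q^{2m}, q^{2m}, 2Σ_{i<m} q^{2i})` in BOTH class variants (flip ★ `shellSum_P_{pos,neg}_succ`, keep ★ `shellSum_P_keep_*`), so one statement serves `q ≡ ±1 (4)`.
The exponent `2m+3 = N = (N₁+N₂)∕2 + … ` is the junction head's `q^m′·X̃` normalisation with `m′ = (N₁+N₂)∕2 = 2m+3` in the equilateral configuration.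
HONEST LABEL: HC_CM is proved only modulo the 2 remaining named inputs (hLiu418 24832, h413 24833) until rung 0 closes; nothing printed is asserted here (finite geometric sums).

## References
* [Rogawski1990] J. D. Rogawski, *Automorphic Representations of Unitary Groups in Three Variables*, Ann. of Math. Stud. 123 (1990), §4.9 Prop. 4.9.1 (a) p. 55 (the five
  brackets of the ramified type-(1) transfer).
* [Kottwitz1986] R. E. Kottwitz, *Base change for unit elements of Hecke algebras*, Compositio Math. 60 (1986), §3 (shell-by-shell counting).
-/

set_option autoImplicit false

open Finset

namespace Literature.NumberTheory.Rogawski1990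

/-- `(q − 1)·Σ_{i<m} qⁱ = q^m − 1` over `ℚ`. [cite: Kottwitz1986, §3] -/
theorem geom_sum_mul_sub_one_rat (q : ℚ) (m : ℕ) : (∑ i ∈ range m, q ^ i) * (q - 1) = q ^ m - 1 := geom_sum_mul q m

/-- The two class variants have the same `S(P⁺_m) + S(P⁻_m) = (0, 0, q^{2m}, q^{2m}, 2Σ_{i<m}q^{2i})` — flip variant. [cite: Kottwitz1986, §3] -/
theorem shellSum_P_pos_add_neg_flip (q m : ℕ) :
    ((![0, 0, if Even m then q ^ (2 * m) else 0, if Even m then 0 else q ^ (2 * m), ∑ i ∈ range m, q ^ (2 * i)] : Fin 5 → ℕ) +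
        ![0, 0, if Even m then 0 else q ^ (2 * m), if Even m then q ^ (2 * m) else 0, ∑ i ∈ range m, q ^ (2 * i)]) =
      ![0, 0, q ^ (2 * m), q ^ (2 * m), 2 * ∑ i ∈ range m, q ^ (2 * i)] := by
  ext j; fin_cases j <;> by_cases hm : Even m <;> simp [hm, two_mul]

/-- The same — keep variant. [cite: Kottwitz1986, §3] -/
theorem shellSum_P_pos_add_neg_keep (q m : ℕ) :
    ((![0, 0, q ^ (2 * m), 0, ∑ i ∈ range m, q ^ (2 * i)] : Fin 5 → ℕ) + ![0, 0, 0, q ^ (2 * m), ∑ i ∈ range m, q ^ (2 * i)]) =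
      ![0, 0, q ^ (2 * m), q ^ (2 * m), 2 * ∑ i ∈ range m, q ^ (2 * i)] := by
  ext j; fin_cases j <;> simp [two_mul]

/-- **THE EQUILATERAL κ-SUM IDENTITY**: `q·(4·S(E_{m+1})_j − 2·(S(P⁺_m) + S(P⁻_m))_j) = q^{2m+3}·X̃_j(m+1)` for each of the five strata, over `ℚ` (`2 ≤ q`), with the ★ closed forms
`S(E_{m+1}) = (q^{3m+3}, q^{3m+2}, C(q,2)q^{2m}Σ_{i<m}qⁱ, same, Σ_{i≤m}q^{2i} + Σ_{i<m}q^{2m+1+i})` and `S(P⁺_m) + S(P⁻_m) = (0, 0, q^{2m}, q^{2m}, 2Σ_{i<m}q^{2i})`.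
[cite: Rogawski1990, §4.9 Prop. 4.9.1 (a) p. 55] [cite: Kottwitz1986, §3] -/
theorem kappaSum_equilateral_eq (q m : ℕ) (hq : 2 ≤ q) (j : Fin 5) :
    (q : ℚ) * (4 * (((![q ^ (3 * m + 3), q ^ (3 * m + 2), q.choose 2 * q ^ (2 * m) * ∑ i ∈ range m, q ^ i, q.choose 2 * q ^ (2 * m) * ∑ i ∈ range m, q ^ i,
          ∑ i ∈ range (m + 1), q ^ (2 * i) + ∑ i ∈ range m, q ^ (2 * m + 1 + i)] : Fin 5 → ℕ) j : ℕ) : ℚ) -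
        2 * (((![0, 0, q ^ (2 * m), q ^ (2 * m), 2 * ∑ i ∈ range m, q ^ (2 * i)] : Fin 5 → ℕ) j : ℕ) : ℚ)) =
      (q : ℚ) ^ (2 * m + 3) *
        (![4 * (q : ℚ) ^ (m + 1), 4 * (q : ℚ) ^ (m + 1 - 1), (2 * ((q : ℚ) ^ (m + 1) - q - 1)) / (q : ℚ) ^ 2, (2 * ((q : ℚ) ^ (m + 1) - q - 1)) / (q : ℚ) ^ 2,
            (4 * ((q : ℚ) ^ (m + 1) - 1)) / (((q : ℚ) - 1) * (q : ℚ) ^ 2)] : Fin 5 → ℚ) j := by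
  have hq0 : (q : ℚ) ≠ 0 := by exact_mod_cast (show q ≠ 0 by omega)
  have hq1 : (q : ℚ) - 1 ≠ 0 := sub_ne_zero.2 (by exact_mod_cast (show q ≠ 1 by omega))
  have hS : (∑ i ∈ range m, (q : ℚ) ^ i) * ((q : ℚ) - 1) = (q : ℚ) ^ m - 1 := geom_sum_mul _ m
  have hC : ((q.choose 2 : ℕ) : ℚ) = (q : ℚ) * ((q : ℚ) - 1) / 2 := Nat.cast_choose_two ℚ q
  have hsum1 : ((∑ i ∈ range m, q ^ i : ℕ) : ℚ) = ∑ i ∈ range m, (q : ℚ) ^ i := by push_cast; rfl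
  have hsum2 : ((∑ i ∈ range m, q ^ (2 * i) : ℕ) : ℚ) = ∑ i ∈ range m, (q : ℚ) ^ (2 * i) := by push_cast; rfl
  have hsum3 : ((∑ i ∈ range (m + 1), q ^ (2 * i) : ℕ) : ℚ) = ∑ i ∈ range m, (q : ℚ) ^ (2 * i) + (q : ℚ) ^ (2 * m) := by
    push_cast; rw [Finset.sum_range_succ]
  have hsum4 : ((∑ i ∈ range m, q ^ (2 * m + 1 + i) : ℕ) : ℚ) = (q : ℚ) ^ (2 * m + 1) * ∑ i ∈ range m, (q : ℚ) ^ i := by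
    push_cast; rw [Finset.mul_sum]; exact Finset.sum_congr rfl (fun i _ => by rw [pow_add])
  fin_cases j
  · simp; ring
  · simp; ring
  · simp only [Fin.reduceFinMk, Matrix.cons_val, Nat.cast_mul, Nat.cast_pow, hC, hsum1]
    field_simp
    linear_combination (4 * (q : ℚ) ^ (2 * m + 4)) * hS
  · simp only [Fin.reduceFinMk, Matrix.cons_val, Nat.cast_mul, Nat.cast_pow, hC, hsum1]
    field_simp
    linear_combination (4 * (q : ℚ) ^ (2 * m + 4)) * hS
  · simp only [Fin.reduceFinMk, Matrix.cons_val, Nat.cast_mul, Nat.cast_add, Nat.cast_ofNat, hsum2, hsum3, hsum4]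
    field_simp
    linear_combination (4 * (q : ℚ) ^ (2 * m + 4)) * hS

end Literature.NumberTheory.Rogawski1990
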